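import Literature.Probability.LatticeModels.NoBadPercolationW
import Literature.Probability.LatticeModels.StarZhangCrossing
import HarnessLib

/-!
# Good paths below the square from good paths above it for the reflected layers (GH2000 L5.5)

Topic `Probability/LatticeModels`; theorems only. Georgii–Higuchi, J. Math. Phys. 41 (2000), proof of
Lemma 5.5 (p. 16): "Together with its analogue for the lower half-plane, the claim implies that
`ν̂(A_{x,y} ∩ B_{x,y}) ≥ ν̂(A_{x,y}) ν̂(B_{x,y})`…". The analogue for the lower half-plane is the claim
for the pair of layers reflected in the horizontal axis, `(ω, ω̂) ↦ (ω ∘ R₁, ω̂ ∘ R₁)`,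
`R₁ (x₁, x₂) = (x₁, -x₂)`: a good `∗`-walk of upper winding type for the reflected layers is, after
reflection, a good `∗`-walk of lower winding type (`Percolation.lowerType_map_reflect`), with the same
axis endpoints and inside the same box.

* `goodBelowW_of_goodAboveW_reflect` — the deterministic step;
* `le_measureReal_goodBelowW_of_reflect` — `c ≤ (μ₁∘R₁⁻¹ ⊗ μ₂∘R₁⁻¹)(A_{x,y})` implies
  `c ≤ (μ₁ ⊗ μ₂)(B_{x,y})` for axis sites `x, y`.

## References

* H.-O. Georgii, Y. Higuchi, J. Math. Phys. 41 (2000) 1153–1169, Lemma 5.5 (proof, p. 16)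
  [GeorgiiHiguchi2000].
-/

noncomputable section

open MeasureTheory Filter SimpleGraph
open Literature.Probability.Percolation
open scoped ENNReal

namespace Literature.Probability.LatticeModels

section Reflect

/-- Lower type is insensitive to rewriting the endpoints of the walk. [folklore] -/
theorem lowerType_copy_iff {m : ℕ} {x y x' y' : Site 2} (W : zdStarGraph.Walk x y) (hx : x = x') (hy : y = y') :
    LowerType m (W.copy hx hy) ↔ LowerType m W := by
  subst hx hy; rw [Walk.copy_rfl_rfl]

/-- The reflection `x₂ ↦ -x₂` preserves boxes. [folklore] -/
theorem reflectCoord_one_mem_box_iff {N : ℕ} (z : Site 2) : reflectCoord 1 z ∈ box 2 N ↔ z ∈ box 2 N := by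
  have h0 : (reflectCoord (d := 2) 1 z) 0 = z 0 := Rf_apply_zero z
  have h1 : (reflectCoord (d := 2) 1 z) 1 = -z 1 := Rf_apply_one z
  simp only [mem_box, Fin.forall_fin_two, h0, h1]
  omega

/-- Bad sites of the reflected pair of layers are the reflected bad sites. [folklore] -/
theorem not_mem_spinSites_badConfig_reflect_iff (p : SpinConfig (Site 2) × SpinConfig (Site 2)) (z : Site 2) :
    z ∉ spinSites 1 (badConfig (configRelabel (reflectCoord (d := 2) 1).toEquiv p.1,
        configRelabel (reflectCoord (d := 2) 1).toEquiv p.2)) ↔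
      reflectCoord 1 z ∉ spinSites 1 (badConfig p) := by
  rw [mem_spinSites_badConfig, mem_spinSites_badConfig]
  simp only [configRelabel_apply, reflectCoord_symm_apply]

/-- **A good walk of upper type for the reflected layers reflects to a good walk of lower type**
(axis endpoints). [cite: GeorgiiHiguchi2000, Lemma 5.5 (proof: "its analogue for the lower half-plane")] -/
theorem goodBelowW_of_goodAboveW_reflect {m H : ℕ} (hm : 1 ≤ m) {x y : Site 2} (hx : x 1 = 0) (hy : y 1 = 0)
    {p : SpinConfig (Site 2) × SpinConfig (Site 2)}
    (h : GoodAboveW m H x y (configRelabel (reflectCoord (d := 2) 1).toEquiv p.1,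
      configRelabel (reflectCoord (d := 2) 1).toEquiv p.2)) :
    GoodBelowW m H x y p := by
  obtain ⟨α, hαU, hα⟩ := h
  have hRx : reflectCoord (d := 2) 1 x = x := by
    funext j; rw [reflectCoord_apply]; fin_cases j <;> simp [hx]
  have hRy : reflectCoord (d := 2) 1 y = y := by
    funext j; rw [reflectCoord_apply]; fin_cases j <;> simp [hy]
  have hsx : (starReflectHom 1) x = x := by rw [starReflectHom_apply]; exact hRx
  have hsy : (starReflectHom 1) y = y := by rw [starReflectHom_apply]; exact hRy
  refine ⟨(α.map (starReflectHom 1)).copy hsx hsy, (lowerType_copy_iff _ hsx hsy).2 (lowerType_map_reflect hm hαU),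
    fun z hz => ?_⟩
  rw [Walk.support_copy, Walk.support_map, List.mem_map] at hz
  obtain ⟨w, hw, rfl⟩ := hz
  rw [starReflectHom_apply]
  obtain ⟨hgood, hbox⟩ := hα w hw
  exact ⟨(not_mem_spinSites_badConfig_reflect_iff p w).1 hgood, (reflectCoord_one_mem_box_iff w).2 hbox⟩

/-- **`B_{x,y}` is at least as likely as `A_{x,y}` for the reflected layers**: for axis sites `x, y`
and `m ≥ 1`, `c ≤ (μ₁∘R₁⁻¹ ⊗ μ₂∘R₁⁻¹)(A_{x,y})` implies `c ≤ (μ₁ ⊗ μ₂)(B_{x,y})`. [cite: GeorgiiHiguchi2000, Lemma 5.5 (proof, p. 16)] -/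
theorem le_measureReal_goodBelowW_of_reflect (μ₁ μ₂ : Measure (SpinConfig (Site 2))) [SFinite μ₁] [SFinite μ₂]
    [IsFiniteMeasure (μ₁.prod μ₂)] {m H : ℕ} (hm : 1 ≤ m) {x y : Site 2} (hx : x 1 = 0) (hy : y 1 = 0) {c : ℝ}
    (h : c ≤ ((μ₁.map (configRelabel (reflectCoord (d := 2) 1).toEquiv)).prod
        (μ₂.map (configRelabel (reflectCoord (d := 2) 1).toEquiv))).real {p | GoodAboveW m H x y p}) :
    c ≤ (μ₁.prod μ₂).real {p | GoodBelowW m H x y p} := by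
  have hρ : Measurable (configRelabel (reflectCoord (d := 2) 1).toEquiv : SpinConfig (Site 2) → SpinConfig (Site 2)) :=
    (configRelabel _).measurable
  rw [Measure.map_prod_map _ _ hρ hρ, measureReal_def, Measure.map_apply (hρ.prodMap hρ) (measurableSet_goodAboveW m H x y)] at h
  rw [measureReal_def]
  refine h.trans (ENNReal.toReal_mono (measure_ne_top _ _) (measure_mono ?_))
  intro p hp
  exact goodBelowW_of_goodAboveW_reflect hm hx hy hp

end Reflect

end Literature.Probability.LatticeModels
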